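import Summits.ValiantsHypothesis.ValiantsHypothesis.Theorems.LacunarySymmetroidMatrixDescartesFiniteSectorSumMasksHigher

/-!
# `MatrixDescartes` — line «finite»: m-FOLD SUM BITMASKS, `m = 6, 7` — bridge theorems for the `K = 4` column cells `(6,4)`, `(7,4)`

HONEST FRAMING.  Object-search cell `pub-symmetroid`, seat val-sym-door-p5 g8.  HELPER material for the crux item `stmt-ValiantsHypothesis-18050` with NO
closure claim and no mathematical content of its own; continuation of `…FiniteSectorSumMasksHigher` (`m = 3, 4, 5`) two sizes up: membership ⇒ bit for the
6- and 7-fold iterated shift masks, prefix pruning for six- and sevenfold sums, unpacking of `Multiset` sums of card `6`, `7`.  Nothing here bears on the crux, the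
doors, or `VP ≠ VNP`.
[folklore] Elementary bit bookkeeping (`Nat.testBit`); no citation is load-bearing.
-/

-- `Summit.ValiantsHypothesis.ValiantsHypothesis.…` repeats a component by the D-0017 layout
-- (single-conjunct summit), which the `dupNamespace` linter flags; the name is mandated.
set_option linter.dupNamespace false

namespace Summit.ValiantsHypothesis.ValiantsHypothesis.Theorems.LacunarySymmetroidMatrixDescartes.FiniteSector

/-! ## Membership ⇒ bit, six- and sevenfold sums -/

/-- **Sixfold sum ⇒ bit** of the 6-fold shift mask. [folklore] -/
theorem testBit_fold6Shift_of_mem {l : List ℕ} {r : ℕ}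
    (h : ∃ x ∈ l, ∃ y ∈ l, ∃ z ∈ l, ∃ w ∈ l, ∃ v ∈ l, ∃ o ∈ l, x + y + z + w + v + o = r) :
    (List.foldr (fun x acc => acc ||| (List.foldr (fun x acc => acc ||| (List.foldr (fun x acc => acc ||| (List.foldr (fun x acc => acc ||| (List.foldr (fun x acc => acc ||| (List.foldr (fun y acc => acc ||| 2 ^ y) 0 l) * 2 ^ x) 0 l) * 2 ^ x) 0 l) * 2 ^ x) 0 l) * 2 ^ x) 0 l) * 2 ^ x) 0 l).testBit r = true := by
  rw [testBit_shiftFold]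
  obtain ⟨x, hx, y, hy, z, hz, w, hw, v, hv, o, ho, hs⟩ := h
  refine Or.inr ⟨x, hx, by omega, ?_⟩
  have : r - x = y + z + w + v + o := by omega
  rw [this]
  exact testBit_fold5Shift_of_mem ⟨y, hy, z, hz, w, hw, v, hv, o, ho, rfl⟩

/-- **Sevenfold sum ⇒ bit** of the 7-fold shift mask. [folklore] -/
theorem testBit_fold7Shift_of_mem {l : List ℕ} {r : ℕ}
    (h : ∃ x ∈ l, ∃ y ∈ l, ∃ z ∈ l, ∃ w ∈ l, ∃ v ∈ l, ∃ o ∈ l, ∃ t ∈ l, x + y + z + w + v + o + t = r) :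
    (List.foldr (fun x acc => acc ||| (List.foldr (fun x acc => acc ||| (List.foldr (fun x acc => acc ||| (List.foldr (fun x acc => acc ||| (List.foldr (fun x acc => acc ||| (List.foldr (fun x acc => acc ||| (List.foldr (fun y acc => acc ||| 2 ^ y) 0 l) * 2 ^ x) 0 l) * 2 ^ x) 0 l) * 2 ^ x) 0 l) * 2 ^ x) 0 l) * 2 ^ x) 0 l) * 2 ^ x) 0 l).testBit r = true := by
  rw [testBit_shiftFold]
  obtain ⟨x, hx, y, hy, z, hz, w, hw, v, hv, o, ho, t, ht, hs⟩ := h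
  refine Or.inr ⟨x, hx, by omega, ?_⟩
  have : r - x = y + z + w + v + o + t := by omega
  rw [this]
  exact testBit_fold6Shift_of_mem ⟨y, hy, z, hz, w, hw, v, hv, o, ho, t, ht, rfl⟩

/-! ## Prefix pruning, six- and sevenfold sums -/

/-- If every element of `l₂` is `≥ x`, a sixfold sum `r < x` of `l₁ ++ l₂` is already one of `l₁`. [folklore] -/
theorem memP6_prefix {l₁ l₂ : List ℕ} {x r : ℕ} (hx : ∀ y ∈ l₂, x ≤ y) (hr : r < x) :
    (∃ p ∈ l₁ ++ l₂, ∃ q ∈ l₁ ++ l₂, ∃ s ∈ l₁ ++ l₂, ∃ t ∈ l₁ ++ l₂, ∃ u ∈ l₁ ++ l₂, ∃ v ∈ l₁ ++ l₂, p + q + s + t + u + v = r) →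
      (∃ p ∈ l₁, ∃ q ∈ l₁, ∃ s ∈ l₁, ∃ t ∈ l₁, ∃ u ∈ l₁, ∃ v ∈ l₁, p + q + s + t + u + v = r) := by
  rintro ⟨p, hp, q, hq, s, hs, t, ht, u, hu, v, hv, hsum⟩
  rw [List.mem_append] at hp hq hs ht hu hv
  rcases hp with hp | hp
  · rcases hq with hq | hq
    · rcases hs with hs | hs
      · rcases ht with ht | ht
        · rcases hu with hu | hu
          · rcases hv with hv | hv
            · exact ⟨p, hp, q, hq, s, hs, t, ht, u, hu, v, hv, hsum⟩
            · have := hx v hv; omega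
          · have := hx u hu; omega
        · have := hx t ht; omega
      · have := hx s hs; omega
    · have := hx q hq; omega
  · have := hx p hp; omega

/-- If every element of `l₂` is `≥ x`, a sevenfold sum `r < x` of `l₁ ++ l₂` is already one of `l₁`. [folklore] -/
theorem memP7_prefix {l₁ l₂ : List ℕ} {x r : ℕ} (hx : ∀ y ∈ l₂, x ≤ y) (hr : r < x) :
    (∃ p ∈ l₁ ++ l₂, ∃ q ∈ l₁ ++ l₂, ∃ s ∈ l₁ ++ l₂, ∃ t ∈ l₁ ++ l₂, ∃ u ∈ l₁ ++ l₂, ∃ v ∈ l₁ ++ l₂, ∃ w ∈ l₁ ++ l₂,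
        p + q + s + t + u + v + w = r) →
      (∃ p ∈ l₁, ∃ q ∈ l₁, ∃ s ∈ l₁, ∃ t ∈ l₁, ∃ u ∈ l₁, ∃ v ∈ l₁, ∃ w ∈ l₁, p + q + s + t + u + v + w = r) := by
  rintro ⟨p, hp, q, hq, s, hs, t, ht, u, hu, v, hv, w, hw, hsum⟩
  rw [List.mem_append] at hp hq hs ht hu hv hw
  rcases hp with hp | hp
  · rcases hq with hq | hq
    · rcases hs with hs | hs
      · rcases ht with ht | ht
        · rcases hu with hu | hu
          · rcases hv with hv | hv
            · rcases hw with hw | hw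
              · exact ⟨p, hp, q, hq, s, hs, t, ht, u, hu, v, hv, w, hw, hsum⟩
              · have := hx w hw; omega
            · have := hx v hv; omega
          · have := hx u hu; omega
        · have := hx t ht; omega
      · have := hx s hs; omega
    · have := hx q hq; omega
  · have := hx p hp; omega

/-! ## Unpacking multiset sums of card 6 and 7 -/

/-- A multiset of card `6` of indices has value sum `d i + d j + d k + d l + d n + d o`. [folklore] -/
theorem exists_sum_eq_of_card_six {K : ℕ} (d : Fin K → ℕ) (s : Multiset (Fin K)) (hs : Multiset.card s = 6) :
    ∃ i j k l n o : Fin K, (s.map d).sum = d i + d j + d k + d l + d n + d o := by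
  obtain ⟨a, t, rfl⟩ : ∃ a t, s = a ::ₘ t := by
    rcases Multiset.empty_or_exists_mem s with h | ⟨a, ha⟩
    · rw [h] at hs; simp at hs
    · exact ⟨a, s.erase a, (Multiset.cons_erase ha).symm⟩
  rw [Multiset.card_cons] at hs
  obtain ⟨i, j, k, l, n, h5⟩ := exists_sum_eq_of_card_five d t (by omega)
  refine ⟨a, i, j, k, l, n, ?_⟩
  rw [Multiset.map_cons, Multiset.sum_cons, h5]
  ring

/-- A multiset of card `7` of indices has value sum `d i + d j + d k + d l + d n + d o + d q`. [folklore] -/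
theorem exists_sum_eq_of_card_seven {K : ℕ} (d : Fin K → ℕ) (s : Multiset (Fin K)) (hs : Multiset.card s = 7) :
    ∃ i j k l n o q : Fin K, (s.map d).sum = d i + d j + d k + d l + d n + d o + d q := by
  obtain ⟨a, t, rfl⟩ : ∃ a t, s = a ::ₘ t := by
    rcases Multiset.empty_or_exists_mem s with h | ⟨a, ha⟩
    · rw [h] at hs; simp at hs
    · exact ⟨a, s.erase a, (Multiset.cons_erase ha).symm⟩
  rw [Multiset.card_cons] at hs
  obtain ⟨i, j, k, l, n, o, h6⟩ := exists_sum_eq_of_card_six d t (by omega)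
  refine ⟨a, i, j, k, l, n, o, ?_⟩
  rw [Multiset.map_cons, Multiset.sum_cons, h6]
  ring

end Summit.ValiantsHypothesis.ValiantsHypothesis.Theorems.LacunarySymmetroidMatrixDescartes.FiniteSector
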